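import Mathlib
import Summits.ABC.ABC.Statement
import Literature.NumberTheory.DiophantineGeometry.AbcImpliesHall

/-!
# The Ramanujan–Nagell face: `abc` (any exponent `< 2`) bounds `q^n ≤ K·(Dq)^6` on `x² + D = q^n`,
# uniformly in the base `q`; Beukers' 1981 anchors certify the same shape base by base (solo-ABC-informed, s15)

For the thin two-parameter family of abc triples `(D, x², qⁿ)` ("generalised Ramanujan–Nagell
equation" `x² + D = qⁿ`) the conjecture `ABC`, used at the single value `ε = 1/2`, gives the
*RN-shape* bound `qⁿ < C⁴ · D⁶ · q⁶` with ONE constant for all bases `q ≥ 2`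
(`soloInformed_rnShape_of_abc`): squares keep a distance `≫ q^{n/6 - 1}` from powers of `q`.
Oesterlé's polynomial abc with an exponent `M ≥ 2` does NOT give this (the member `x²` contributes
`rad(x²)^M = x^M ≥ x² ≈ qⁿ`); an exponent `< 2` is what is used.

Unconditionally the RN-shape is a THEOREM exactly for the bases that carry an *anchor* in the sense of
F. Beukers, *On the generalized Ramanujan–Nagell equation I*, Acta Arith. 38 (1981) 389–410,
Theorem 5 (p. 405): a non-square `N`, an odd power `w = N^m` and `x² + Δ = w` with
`w > 2^{5(2−e)/2}|Δ|^{7/2}` and `w > 2^{17−5e}` (`e = 0, 1, 2` for `Δ` odd, `2 ∥ Δ`, `4 ∣ Δ`) give the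
effective measure `|y/√P − 1| > w⁻³P^{−ν}/16`, `ν = 5/6 + (17−5e)·log 2/(6 log w) < 1`, for every odd
power `P` of `N`, hence `n(1−ν)·log N < log(16w³D)` on `x² + D = Nⁿ` (ibid. Cor. 1, p. 394, is the case
`N = 2`: `n < 435 + 10·log|D|/log 2`). The anchors are exact finite data; the ones recorded below
(`soloInformed_beukers_anchor_*`, integer form `w² > 2^{5(2−e)}|Δ|^7 ∧ w > 2^{17−5e}`) are Beukers'
examples `(Δ,w) = (−37, 3^15), (−26, 23^5)` (ibid. p. 405, Remark) and the seat's search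
(run/shared/lean/ideation/ABC/solo-informed/work/s15/anchors2.out: 12 of the 303 primes below 2000 are
anchored at height `N^m ≤ 10^120`; `5, 7, 11, 13, 17, 19` are not, `13` and `37` missing by a factor `< 8`).
[cite: Beukers1981, Acta Arith. 38, Thm 5 p.405, Cor. 1 p.394]
-/

namespace Summit.ABC.ABC.Theorems

open Literature.NumberTheory.DiophantineGeometry UniqueFactorizationMonoid

/-- The radical of the Ramanujan–Nagell triple: `rad(D · x² · qⁿ) ≤ D · x · q`. [folklore] -/
theorem soloInformed_rad_rn_le {D x q n : ℕ} (hx : 0 < x) (hq : 0 < q) (hD : 0 < D) :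
    rad D (x ^ 2) (q ^ n) ≤ D * x * q := by
  rw [rad_def]
  calc radical (D * x ^ 2 * q ^ n) ≤ radical D * radical (x ^ 2) * radical (q ^ n) :=
        radical_mul_three_le _ _ _
    _ ≤ D * x * q := by
        gcongr
        · exact Nat.radical_le_self_iff.mpr hD.ne'
        · exact radical_le_of_dvd_pow hx.ne' (dvd_refl _)
        · exact radical_le_of_dvd_pow hq.ne' (dvd_refl _)

/-- `(D, x², qⁿ)` with `x² + D = qⁿ`, `D, x > 0`, `gcd(D, x) = 1` is an abc triple. [folklore] -/
theorem soloInformed_isABCTriple_rn {D x q n : ℕ} (hx : 0 < x) (hD : 0 < D) (hcop : Nat.Coprime D x)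
    (h : x ^ 2 + D = q ^ n) : IsABCTriple D (x ^ 2) (q ^ n) :=
  ⟨hD, by positivity, by omega, Nat.Coprime.pow_right 2 hcop⟩

/-- **RN-shape from abc, uniformly in the base.** `ABC` (at `ε = 1/2`) gives one constant `K` with
`qⁿ < K · D⁶ · q⁶` for all `q ≥ 1`, `x, D ≥ 1` coprime and `n` with `x² + D = qⁿ`. [folklore] -/
theorem soloInformed_rnShape_of_abc (habc : _root_.ABC) :
    ∃ K : ℝ, 0 < K ∧ ∀ q x D n : ℕ, 0 < q → 0 < x → 0 < D → Nat.Coprime D x →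
      x ^ 2 + D = q ^ n → ((q : ℝ) ^ n) < K * (D : ℝ) ^ 6 * (q : ℝ) ^ 6 := by
  obtain ⟨C, hC, hC'⟩ := (_root_.ABC_iff.mp habc) (1 / 2) (by norm_num)
  refine ⟨C ^ 4, by positivity, fun q x D n hq hx hD hcop h => ?_⟩
  have ht := soloInformed_isABCTriple_rn hx hD hcop h
  have hlt := hC' D (x ^ 2) (q ^ n) ht
  -- name the real quantities
  set c : ℝ := ((q ^ n : ℕ) : ℝ) with hc_def
  set r : ℝ := ((rad D (x ^ 2) (q ^ n) : ℕ) : ℝ) with hr_def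
  have hc0 : 0 < c := by rw [hc_def]; exact_mod_cast pow_pos hq n
  have hr0 : 0 ≤ r := by rw [hr_def]; exact_mod_cast Nat.zero_le _
  -- c < C * r^{3/2}  ⟹  c^4 < C^4 * r^6
  have h32 : (1 : ℝ) + 1 / 2 = 3 / 2 := by norm_num
  rw [h32] at hlt
  have hpos : 0 ≤ C * r ^ ((3 : ℝ) / 2) := by positivity
  have h4 : c ^ 4 < (C * r ^ ((3 : ℝ) / 2)) ^ 4 := pow_lt_pow_left₀ hlt hc0.le (by norm_num)
  have hr6 : (r ^ ((3 : ℝ) / 2)) ^ 4 = r ^ 6 := by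
    rw [← Real.rpow_mul_natCast hr0]
    norm_num
  rw [mul_pow, hr6] at h4
  -- r ≤ D x q in ℕ, and x² ≤ qⁿ, so r^6 ≤ D^6 q^6 (qⁿ)^3
  have hrle : rad D (x ^ 2) (q ^ n) ≤ D * x * q := soloInformed_rad_rn_le hx hq hD
  have hx2 : x ^ 2 ≤ q ^ n := by omega
  have hnat : (rad D (x ^ 2) (q ^ n)) ^ 6 ≤ D ^ 6 * q ^ 6 * (q ^ n) ^ 3 := by
    calc (rad D (x ^ 2) (q ^ n)) ^ 6 ≤ (D * x * q) ^ 6 := Nat.pow_le_pow_left hrle 6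
      _ = D ^ 6 * q ^ 6 * (x ^ 2) ^ 3 := by ring
      _ ≤ D ^ 6 * q ^ 6 * (q ^ n) ^ 3 := by gcongr
  have hreal : r ^ 6 ≤ (D : ℝ) ^ 6 * (q : ℝ) ^ 6 * c ^ 3 := by
    rw [hr_def, hc_def]; exact_mod_cast hnat
  -- combine: c^4 < C^4 D^6 q^6 c^3, divide by c^3
  have h5 : c ^ 4 < C ^ 4 * ((D : ℝ) ^ 6 * (q : ℝ) ^ 6 * c ^ 3) := by
    calc c ^ 4 < C ^ 4 * r ^ 6 := h4
      _ ≤ C ^ 4 * ((D : ℝ) ^ 6 * (q : ℝ) ^ 6 * c ^ 3) := by gcongr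
  have hc3 : 0 < c ^ 3 := by positivity
  have h6 : c * c ^ 3 < (C ^ 4 * (D : ℝ) ^ 6 * (q : ℝ) ^ 6) * c ^ 3 := by
    calc c * c ^ 3 = c ^ 4 := by ring
      _ < C ^ 4 * ((D : ℝ) ^ 6 * (q : ℝ) ^ 6 * c ^ 3) := h5
      _ = (C ^ 4 * (D : ℝ) ^ 6 * (q : ℝ) ^ 6) * c ^ 3 := by ring
  have h7 : c < C ^ 4 * (D : ℝ) ^ 6 * (q : ℝ) ^ 6 := lt_of_mul_lt_mul_right h6 hc3.le
  have hcq : c = (q : ℝ) ^ n := by rw [hc_def]; push_cast; ring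
  rw [hcq] at h7
  exact h7

/-- The RN-shape in logarithmic form: `n·log q < log K + 6 log D + 6 log q` (for `q ≥ 2` divide by
`log q > 0`: `n < 6 + (log K + 6 log D)/log q`, ONE `K` for every base). [folklore] -/
theorem soloInformed_rnShape_log_of_abc (habc : _root_.ABC) :
    ∃ K : ℝ, 0 < K ∧ ∀ q x D n : ℕ, 0 < q → 0 < x → 0 < D → Nat.Coprime D x →
      x ^ 2 + D = q ^ n →
        (n : ℝ) * Real.log q < Real.log K + 6 * Real.log D + 6 * Real.log q := by
  obtain ⟨K, hK, hK'⟩ := soloInformed_rnShape_of_abc habc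
  refine ⟨K, hK, fun q x D n hq hx hD hcop h => ?_⟩
  have hlt := hK' q x D n hq hx hD hcop h
  have hq0 : (0 : ℝ) < q := by exact_mod_cast hq
  have hD0 : (0 : ℝ) < D := by exact_mod_cast hD
  have hl := Real.log_lt_log (by positivity) hlt
  rw [Real.log_pow, Real.log_mul (by positivity) (by positivity), Real.log_mul hK.ne' (by positivity),
    Real.log_pow, Real.log_pow] at hl
  push_cast at hl
  linarith

/-! ### Beukers anchors (Theorem 5 hypotheses, integer form) — exact finite data -/

/-- Beukers' example `(Δ, w) = (−37, 3^15)`: `3788² − 37 = 3^15`, `w² > 2^10·37^7`, `w > 2^17`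
(Acta Arith. 38 (1981), p. 405, Remark; `e = 0`). Consequence (Thm 5, `ν = 0.9525…`):
`x² + D = 3ⁿ`, `n` odd ⟹ `n < 1000.5 + 19.16·log D`. [cite: Beukers1981, Acta Arith. 38, p.405] -/
theorem soloInformed_beukers_anchor_3 :
    3788 ^ 2 = 3 ^ 15 + 37 ∧ (3 ^ 15) ^ 2 > 2 ^ 10 * 37 ^ 7 ∧ 3 ^ 15 > 2 ^ 17 := by norm_num

/-- Beukers' example `(Δ, w) = (−26, 23^5)`: `2537² − 26 = 23^5` (`e = 1`: `w² > 2^5·26^7`, `w > 2^12`).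
[cite: Beukers1981, Acta Arith. 38, p.405] -/
theorem soloInformed_beukers_anchor_23 :
    2537 ^ 2 = 23 ^ 5 + 26 ∧ (23 ^ 5) ^ 2 > 2 ^ 5 * 26 ^ 7 ∧ 23 ^ 5 > 2 ^ 12 := by norm_num

/-- Base 2 is anchored at `w = 2^17 = 362² + 28` (`e = 2`: `w² > 28^7`, `w > 2^7`); the seed of
Beukers' Theorem 1, `181² + 7 = 2^15`, satisfies the proof's condition `2^30 > 2^10·7^7` but not
Theorem 5's `w > 2^17`. [cite: Beukers1981, Acta Arith. 38, Thm 1 p.392, Thm 5 p.405] -/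
theorem soloInformed_beukers_anchor_2 :
    362 ^ 2 + 28 = 2 ^ 17 ∧ (2 ^ 17) ^ 2 > 28 ^ 7 ∧ 2 ^ 17 > 2 ^ 7 ∧
    181 ^ 2 + 7 = 2 ^ 15 ∧ (2 ^ 15) ^ 2 > 2 ^ 10 * 7 ^ 7 ∧ ¬ (2 ^ 15 > 2 ^ 17) := by norm_num

/-- Anchors found by search (seat, s15) for the primes `73, 109, 173`:
`45531² = 73^5 + 368` (`Δ = −368`, `e = 2`), `1138² = 109^3 + 15` (`Δ = −15`, `e = 0`), `13² + 4 = 173` (`e = 2`). [folklore] -/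
theorem soloInformed_beukers_anchor_73_109_173 :
    (45531 ^ 2 = 73 ^ 5 + 368 ∧ (73 ^ 5) ^ 2 > 368 ^ 7 ∧ 73 ^ 5 > 2 ^ 7) ∧
    (1138 ^ 2 = 109 ^ 3 + 15 ∧ (109 ^ 3) ^ 2 > 2 ^ 10 * 15 ^ 7 ∧ 109 ^ 3 > 2 ^ 17) ∧
    (13 ^ 2 + 4 = 173 ∧ 173 ^ 2 > 4 ^ 7 ∧ 173 > 2 ^ 7) := by norm_num

/-- The two nearest misses below 50: `47² − 12 = 13³` and `225² + 28 = 37³` violate the anchor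
inequality (`(13³)² < 12^7`, `(37³)² < 28^7`, both `e = 2`), by factors `< 8`. [folklore] -/
theorem soloInformed_beukers_nonanchor_13_37 :
    47 ^ 2 = 13 ^ 3 + 12 ∧ ¬ ((13 ^ 3) ^ 2 > 12 ^ 7) ∧ 12 ^ 7 < 8 * (13 ^ 3) ^ 2 ∧
    225 ^ 2 + 28 = 37 ^ 3 ∧ ¬ ((37 ^ 3) ^ 2 > 28 ^ 7) ∧ 28 ^ 7 < 8 * (37 ^ 3) ^ 2 := by norm_num

end Summit.ABC.ABC.Theorems
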